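import Summits.CriticalPhenomena.PercolationContinuityZ3.Theorems.PercNearOneGluingNoHeavyQuantFarEarAtObserverReach
import HarnessLib

/-!
# QUANT lane R8, front "FAR beyond trees", layer one — THE DEGREE-THREE GATE AT THE OBSERVER, I: reachability through one vertex

builds on p205010 (kernel theorem, internal audit signed; external expert review pending)

Support file (`--supports stmt-CriticalPhenomena-4575`), seat `prim-quant-p1` (gen 28); memo
`run/shared/lean/prim/quant/prim-quant-p1-g28/FOR-LEAD-GATE3.md`.  Pure combinatorics of open paths (no measure); standard axioms;
no sorries; no definitions.

**Setting** (p1 g27 memo §7(a), the next observer-local configuration after the ear and the haired ear).  Vertices `Fin n`; the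
observer `o`; a relay `v` whose only positive pairs are `s(o, v)` (to the observer) and `s(v, u₁)`, `s(v, u₂)` to two further relays
`u₁, u₂` (which may have arbitrary further pairs) — a DEGREE-THREE GATE at the observer.  A configuration `ω` is GOOD when every other
pair at `v` is absent (`s(v, z) ∉ ω` for `z ∉ {o, u₁, u₂, v}`) — almost surely so (file II).  Write `x ~ y off v` for reachability
through the open pairs avoiding `v` (`Bundle.offZ {v}`).

* **`Gate3.reach_iff_off_vertex`** (general, any configuration, any vertex `v`): for `x, y ≠ v`,
  `x ↔ y ⟺ x ~ y off v ∨ ∃ z z' ≠ v, s(z,v), s(v,z') open ∧ x ~ z off v ∧ z' ~ y off v` (an open walk either avoids `v` or is cut at its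
  first and last visits to `v`); **`Gate3.reach_vertex_iff`**: for `x ≠ v`, `x ↔ v ⟺ ∃ z ≠ v, s(z,v) open ∧ x ~ z off v`.
* On a good configuration of the gate (`VR := s(o,v) ∈ ω ∨ (s(v,u₁) ∈ ω ∧ o ~ u₁ off v) ∨ (s(v,u₂) ∈ ω ∧ o ~ u₂ off v)`):
  **`Gate3.reach_v_iff`**: `o ↔ v ⟺ VR`;  **`Gate3.reach_iff_of_ne`**: for `y ≠ v`,
  `o ↔ y ⟺ o ~ y off v ∨ (VR ∧ ((s(v,u₁) ∈ ω ∧ u₁ ~ y off v) ∨ (s(v,u₂) ∈ ω ∧ u₂ ~ y off v)))`.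
* **`Gate3.two_le_card`**: if two of `o ↔ v`, `o ↔ u₁`, `o ↔ u₂` hold then `2 ≤ #{a ∈ A : o ↔ a}` (`v, u₁, u₂ ∈ A` distinct).
So the observer's connections are an explicit function of the three independent pairs at `v` and of the off-`v` configuration — the
structure integrated in file II.  [cite: Grimmett1999, §1.3 p. 10] (open paths / clusters); the bookkeeping is [this work].
-/

namespace Summit.CriticalPhenomena.PercolationContinuityZ3.Theorems

namespace Quant

namespace Gate3

open Finset
open Literature.Probability.Percolation
open Bundle (offZ offZ_subset reachable_of_offZ)
open scoped Classical

variable {n : ℕ}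

/-! ## Cutting an open walk at one vertex (general) -/

/-- **The walk invariant at a vertex `v`.**  Along an open walk from `x` to a target `y ≠ v`: if `x ≠ v` then `x ~ y off v`, or the walk
visits `v`, entering it first from some `z ≠ v` with `x ~ z off v` and leaving it last towards some `z' ≠ v` with `z' ~ y off v`; if `x = v`
then the walk leaves `v` last towards some `z' ≠ v` with `z' ~ y off v`. [this work] -/
theorem inv_of_walk {ω : BondConfig (Fin n)} {v : Fin n} :
    ∀ (x y : Fin n) (_ : (openGraph ω).Walk x y), y ≠ v →
      (x ≠ v → ((openGraph (offZ {v} ω)).Reachable x y ∨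
        ∃ z z' : Fin n, z ≠ v ∧ z' ≠ v ∧ s(z, v) ∈ ω ∧ s(v, z') ∈ ω ∧
          (openGraph (offZ {v} ω)).Reachable x z ∧ (openGraph (offZ {v} ω)).Reachable z' y)) ∧
      (x = v → ∃ z' : Fin n, z' ≠ v ∧ s(v, z') ∈ ω ∧ (openGraph (offZ {v} ω)).Reachable z' y) := by
  intro x y W
  induction W with
  | nil => exact fun hy => ⟨fun _ => Or.inl (SimpleGraph.Reachable.refl _), fun h => absurd h hy⟩
  | @cons a b c hadj W' ih =>
    intro hy
    have ih' := ih hy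
    rw [openGraph_adj] at hadj
    obtain ⟨hab, hne⟩ := hadj
    refine ⟨fun hav => ?_, fun hav => ?_⟩
    · by_cases hbv : b = v
      · -- the step enters `v`
        subst hbv
        obtain ⟨z', hz'v, hvz', hr⟩ := ih'.2 rfl
        exact Or.inr ⟨a, z', hav, hz'v, hab, hvz', SimpleGraph.Reachable.refl _, hr⟩
      · have hadj' : (openGraph (offZ {v} ω)).Adj a b := EarAtObserver.adj_off hne hab hav hbv
        rcases ih'.1 hbv with h | ⟨z, z', hzv, hz'v, hzv', hvz', hbz, hz'c⟩
        · exact Or.inl (hadj'.reachable.trans h)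
        · exact Or.inr ⟨z, z', hzv, hz'v, hzv', hvz', hadj'.reachable.trans hbz, hz'c⟩
    · -- the walk starts at `v`; the first step goes to `b ≠ v`
      subst hav
      have hbv : b ≠ a := fun h => hne h.symm
      rcases ih'.1 hbv with h | ⟨z, z', -, hz'v, -, hvz', -, hz'c⟩
      · exact ⟨b, hbv, hab, h⟩
      · exact ⟨z', hz'v, hvz', hz'c⟩

/-- **Vertices other than `v`** (general).  For `x, y ≠ v`:
`x ↔ y ⟺ x ~ y off v ∨ ∃ z z' ≠ v, s(z,v) ∈ ω ∧ s(v,z') ∈ ω ∧ x ~ z off v ∧ z' ~ y off v`. [this work] -/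
theorem reach_iff_off_vertex {ω : BondConfig (Fin n)} {v x y : Fin n} (hx : x ≠ v) (hy : y ≠ v) :
    (openGraph ω).Reachable x y ↔ (openGraph (offZ {v} ω)).Reachable x y ∨
      ∃ z z' : Fin n, z ≠ v ∧ z' ≠ v ∧ s(z, v) ∈ ω ∧ s(v, z') ∈ ω ∧
        (openGraph (offZ {v} ω)).Reachable x z ∧ (openGraph (offZ {v} ω)).Reachable z' y := by
  constructor
  · rintro ⟨W⟩
    exact (inv_of_walk x y W hy).1 hx
  · rintro (h | ⟨z, z', hzv, hz'v, hzv', hvz', hxz, hz'y⟩)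
    · exact reachable_of_offZ h
    · have h1 : (openGraph ω).Adj z v := by rw [openGraph_adj]; exact ⟨hzv', hzv⟩
      have h2 : (openGraph ω).Adj v z' := by rw [openGraph_adj]; exact ⟨hvz', fun h => hz'v h.symm⟩
      exact (reachable_of_offZ hxz).trans (h1.reachable.trans (h2.reachable.trans (reachable_of_offZ hz'y)))

/-- **The vertex `v` itself** (general).  For `x ≠ v`: `x ↔ v ⟺ ∃ z ≠ v, s(z,v) ∈ ω ∧ x ~ z off v`. [this work] -/
theorem reach_vertex_iff {ω : BondConfig (Fin n)} {v x : Fin n} (hx : x ≠ v) :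
    (openGraph ω).Reachable x v ↔ ∃ z : Fin n, z ≠ v ∧ s(z, v) ∈ ω ∧ (openGraph (offZ {v} ω)).Reachable x z := by
  constructor
  · intro h
    obtain ⟨W⟩ := h.symm
    obtain ⟨z', hz'v, hvz', hr⟩ := (inv_of_walk v x W hx).2 rfl
    refine ⟨z', hz'v, ?_, hr.symm⟩
    rw [Sym2.eq_swap]; exact hvz'
  · rintro ⟨z, hzv, hzv', hxz⟩
    have h1 : (openGraph ω).Adj z v := by rw [openGraph_adj]; exact ⟨hzv', hzv⟩
    exact (reachable_of_offZ hxz).trans h1.reachable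

/-! ## The degree-three gate on a good configuration -/

section Good

variable {o v u₁ u₂ : Fin n} {ω : BondConfig (Fin n)}
  (hω : ∀ z : Fin n, z ≠ o → z ≠ u₁ → z ≠ u₂ → z ≠ v → s(v, z) ∉ ω)
  (hov : o ≠ v) (h1v : u₁ ≠ v) (h2v : u₂ ≠ v)
include hω hov h1v h2v

omit hov h1v h2v in
/-- On a good configuration an open pair at `v` goes to `o`, `u₁` or `u₂`. [this work] -/
theorem eq_of_mem {z : Fin n} (hzv : z ≠ v) (hz : s(z, v) ∈ ω) : z = o ∨ z = u₁ ∨ z = u₂ := by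
  by_contra h
  simp only [not_or] at h
  exact hω z h.1 h.2.1 h.2.2 hzv (by rw [Sym2.eq_swap]; exact hz)

/-- **The relay `v`.**  On a good configuration:
`o ↔ v ⟺ s(o,v) ∈ ω ∨ (s(v,u₁) ∈ ω ∧ o ~ u₁ off v) ∨ (s(v,u₂) ∈ ω ∧ o ~ u₂ off v)`. [this work] -/
theorem reach_v_iff : (openGraph ω).Reachable o v ↔
    s(o, v) ∈ ω ∨ (s(v, u₁) ∈ ω ∧ (openGraph (offZ {v} ω)).Reachable o u₁) ∨
      (s(v, u₂) ∈ ω ∧ (openGraph (offZ {v} ω)).Reachable o u₂) := by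
  rw [reach_vertex_iff hov]
  constructor
  · rintro ⟨z, hzv, hzv', hoz⟩
    rcases eq_of_mem hω hzv hzv' with rfl | rfl | rfl
    · exact Or.inl hzv'
    · exact Or.inr (Or.inl ⟨by rw [Sym2.eq_swap]; exact hzv', hoz⟩)
    · exact Or.inr (Or.inr ⟨by rw [Sym2.eq_swap]; exact hzv', hoz⟩)
  · rintro (h | ⟨h, hr⟩ | ⟨h, hr⟩)
    · exact ⟨o, hov, h, SimpleGraph.Reachable.refl _⟩
    · exact ⟨u₁, h1v, by rw [Sym2.eq_swap]; exact h, hr⟩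
    · exact ⟨u₂, h2v, by rw [Sym2.eq_swap]; exact h, hr⟩

/-- **Vertices other than `v`.**  On a good configuration, for `y ≠ v`: `o ↔ y ⟺ o ~ y off v ∨ (o ↔ v ∧ ((s(v,u₁) ∈ ω ∧ u₁ ~ y off v)
∨ (s(v,u₂) ∈ ω ∧ u₂ ~ y off v)))` (with `o ↔ v` as in `reach_v_iff`). [this work] -/
theorem reach_iff_of_ne {y : Fin n} (hy : y ≠ v) :
    (openGraph ω).Reachable o y ↔ (openGraph (offZ {v} ω)).Reachable o y ∨
      ((s(o, v) ∈ ω ∨ (s(v, u₁) ∈ ω ∧ (openGraph (offZ {v} ω)).Reachable o u₁) ∨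
          (s(v, u₂) ∈ ω ∧ (openGraph (offZ {v} ω)).Reachable o u₂)) ∧
        ((s(v, u₁) ∈ ω ∧ (openGraph (offZ {v} ω)).Reachable u₁ y) ∨
          (s(v, u₂) ∈ ω ∧ (openGraph (offZ {v} ω)).Reachable u₂ y))) := by
  rw [reach_iff_off_vertex hov hy]
  constructor
  · rintro (h | ⟨z, z', hzv, hz'v, hzv', hvz', hoz, hz'y⟩)
    · exact Or.inl h
    · -- `z' ∈ {o, u₁, u₂}`; if `z' = o` the walk from `o` is not needed
      rcases eq_of_mem hω hz'v (by rw [Sym2.eq_swap]; exact hvz') with rfl | rfl | rfl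
      · exact Or.inl hz'y
      · refine Or.inr ⟨?_, Or.inl ⟨hvz', hz'y⟩⟩
        rcases eq_of_mem hω hzv hzv' with rfl | rfl | rfl
        · exact Or.inl hzv'
        · exact Or.inr (Or.inl ⟨by rw [Sym2.eq_swap]; exact hzv', hoz⟩)
        · exact Or.inr (Or.inr ⟨by rw [Sym2.eq_swap]; exact hzv', hoz⟩)
      · refine Or.inr ⟨?_, Or.inr ⟨hvz', hz'y⟩⟩
        rcases eq_of_mem hω hzv hzv' with rfl | rfl | rfl
        · exact Or.inl hzv'
        · exact Or.inr (Or.inl ⟨by rw [Sym2.eq_swap]; exact hzv', hoz⟩)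
        · exact Or.inr (Or.inr ⟨by rw [Sym2.eq_swap]; exact hzv', hoz⟩)
  · rintro (h | ⟨hV, hout⟩)
    · exact Or.inl h
    · -- assemble `z` from `VR` and `z'` from the exit
      have hz : ∃ z : Fin n, z ≠ v ∧ s(z, v) ∈ ω ∧ (openGraph (offZ {v} ω)).Reachable o z := by
        rcases hV with h | ⟨h, hr⟩ | ⟨h, hr⟩
        · exact ⟨o, hov, h, SimpleGraph.Reachable.refl _⟩
        · exact ⟨u₁, h1v, by rw [Sym2.eq_swap]; exact h, hr⟩
        · exact ⟨u₂, h2v, by rw [Sym2.eq_swap]; exact h, hr⟩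
      obtain ⟨z, hzv, hzv', hoz⟩ := hz
      rcases hout with ⟨h, hr⟩ | ⟨h, hr⟩
      · exact Or.inr ⟨z, u₁, hzv, h1v, hzv', h, hoz, hr⟩
      · exact Or.inr ⟨z, u₂, hzv, h2v, hzv', h, hoz, hr⟩

end Good

/-! ## The relay count -/

/-- **Two of the three gate relays give two relays.**  If `v, u₁, u₂ ∈ A` are distinct and two of `o ↔ v`, `o ↔ u₁`, `o ↔ u₂` hold,
then `2 ≤ #{a ∈ A : o ↔ a}`. [this work] -/
theorem two_le_card {o v u₁ u₂ : Fin n} {ω : BondConfig (Fin n)} {A : Finset (Fin n)}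
    (hvA : v ∈ A) (h1A : u₁ ∈ A) (h2A : u₂ ∈ A) (h1v : u₁ ≠ v) (h2v : u₂ ≠ v) (h12 : u₁ ≠ u₂)
    (h : ((openGraph ω).Reachable o v ∧ (openGraph ω).Reachable o u₁) ∨
      ((openGraph ω).Reachable o v ∧ (openGraph ω).Reachable o u₂) ∨
      ((openGraph ω).Reachable o u₁ ∧ (openGraph ω).Reachable o u₂)) :
    2 ≤ (A.filter fun a => ω ∈ openConn o a).card := by
  have key : ∀ x y : Fin n, x ≠ y → x ∈ A → y ∈ A → (openGraph ω).Reachable o x → (openGraph ω).Reachable o y →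
      2 ≤ (A.filter fun a => ω ∈ openConn o a).card := by
    intro x y hxy hx hy hrx hry
    have hsub : ({x, y} : Finset (Fin n)) ⊆ A.filter fun a => ω ∈ openConn o a := by
      intro a ha
      rw [mem_insert, mem_singleton] at ha
      rcases ha with rfl | rfl
      · exact mem_filter.2 ⟨hx, hrx⟩
      · exact mem_filter.2 ⟨hy, hry⟩
    have hc : ({x, y} : Finset (Fin n)).card = 2 := card_pair hxy
    exact hc ▸ card_le_card hsub
  rcases h with ⟨hv, h1⟩ | ⟨hv, h2⟩ | ⟨h1, h2⟩
  · exact key v u₁ h1v.symm hvA h1A hv h1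
  · exact key v u₂ h2v.symm hvA h2A hv h2
  · exact key u₁ u₂ h12 h1A h2A h1 h2

/-- Contrapositive form used by file II: `#{a ∈ A : o ↔ a} ≤ 1` excludes two of the three. [this work] -/
theorem not_two_of_card_le_one {o v u₁ u₂ : Fin n} {ω : BondConfig (Fin n)} {A : Finset (Fin n)}
    (hvA : v ∈ A) (h1A : u₁ ∈ A) (h2A : u₂ ∈ A) (h1v : u₁ ≠ v) (h2v : u₂ ≠ v) (h12 : u₁ ≠ u₂)
    (h : (A.filter fun a => ω ∈ openConn o a).card ≤ 1) :
    ¬ (((openGraph ω).Reachable o v ∧ (openGraph ω).Reachable o u₁) ∨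
      ((openGraph ω).Reachable o v ∧ (openGraph ω).Reachable o u₂) ∨
      ((openGraph ω).Reachable o u₁ ∧ (openGraph ω).Reachable o u₂)) := fun h2 => by
  have := two_le_card hvA h1A h2A h1v h2v h12 h2
  omega

end Gate3

end Quant

end Summit.CriticalPhenomena.PercolationContinuityZ3.Theorems
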